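import Literature.Analysis.FluidPDE.PassiveScalarEnergyL1Sobolev
import Literature.Analysis.FluidPDE.PassiveScalarSpectralBounds
import Literature.Analysis.FunctionSpaces.TorusSobolevNormProofs
import Literature.Analysis.FunctionSpaces.TorusMaximalLipschitz
import HarnessLib

/-!
# Uniqueness of weak solutions of the passive scalar equation with `L¹ₜ Ḣ¹ₓ` drift

Analysis/FluidPDE proof-support file (everything proved). **DiPerna–Lions uniqueness at
Sobolev level, `p = q = 2`, with viscosity**: for `κ > 0` and a drift `u ∈ L¹(0,T; L²)` (part
of the solution notion) with `∫₀ᵀ ‖∇u(t)‖_{L²} dt < ∞`, two weak solutions of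
`∂ₜθ + u·∇θ = κΔθ` in the class `Torus.IsWeakScalarTransportOn` (`θ ∈ L^∞ₜ L²ₓ`) with the same
datum agree a.e. (`IsWeakScalarTransportOn.unique_of_lintegral_eGradNormSq_rpow_lt_top`).

Proof: the difference is a weak solution with zero datum (`sub_of_eq_datum`, linearity of the
class); the renormalised energy inequality for `L¹ₜḢ¹ₓ` drifts
(`energy_ineq_of_lintegral_eGradNormSq_rpow_lt_top`, DiPerna–Lions 1989, §II.3) gives
`∫⁻ eScalarGradNormSq (θ₁ - θ₂)(t) = 0`, so a.e. slice has vanishing nonzero Fourier modes;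
its mean vanishes too (conservation of the mean, `ae_seis_good`), whence the slice vanishes
a.e. (Fourier uniqueness, `Torus.ae_eq_zero_of_forall_mFourierCoeff_eq_zero`).

## References

* R. J. DiPerna, P.-L. Lions, Invent. Math. 98 (1989), §II.3–II.4, Thm. II.2–II.3. [`DiPernaLions1989`]
-/

noncomputable section

open MeasureTheory Set Function Filter Topology UnitAddTorus
open scoped ENNReal NNReal InnerProductSpace
open Literature.Analysis.FunctionSpaces

namespace Literature.Analysis.FluidPDE

namespace Torus

variable {d : Type*} [Fintype d]

namespace IsWeakScalarTransportOn

variable {T κ : ℝ} {u : ℝ → UnitAddTorus d → EuclideanSpace ℝ d} {θ₀ : UnitAddTorus d → ℝ}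
  {θ₁ θ₂ : ℝ → UnitAddTorus d → ℝ}

/-- **Linearity of the weak class**: the difference of two weak solutions with the same drift
and datum is a weak solution with zero datum. [folklore] -/
theorem sub_of_eq_datum (h₁ : IsWeakScalarTransportOn T κ u θ₀ θ₁) (h₂ : IsWeakScalarTransportOn T κ u θ₀ θ₂) :
    IsWeakScalarTransportOn T κ u 0 (fun t x => θ₁ t x - θ₂ t x) := by
  obtain ⟨C₁, hC₁⟩ := h₁.ae_lintegral_sq_le
  obtain ⟨C₂, hC₂⟩ := h₂.ae_lintegral_sq_le
  refine ⟨h₁.aestronglyMeasurable.sub h₂.aestronglyMeasurable, h₁.aestronglyMeasurable_velocity,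
    ⟨2 * C₁ + 2 * C₂, ?_⟩, h₁.lintegral_velocity_lt_top, ?_, h₁.ae_isWeaklyDivFree, fun ψ hψ => ?_⟩
  · -- `L^∞ₜ L²ₓ`
    filter_upwards [hC₁, hC₂, h₁.ae_aestronglyMeasurable_slice] with t ht₁ ht₂ hm₁
    calc ∫⁻ x, ‖θ₁ t x - θ₂ t x‖ₑ ^ 2 ≤ ∫⁻ x, (2 * ‖θ₁ t x‖ₑ ^ 2 + 2 * ‖θ₂ t x‖ₑ ^ 2) := by
          refine lintegral_mono fun x => (le_trans ?_ (FunctionSpaces.Torus.ennreal_add_sq_le _ _))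
          gcongr
          exact enorm_sub_le
      _ = (∫⁻ x, 2 * ‖θ₁ t x‖ₑ ^ 2) + ∫⁻ x, 2 * ‖θ₂ t x‖ₑ ^ 2 :=
          lintegral_add_left' ((hm₁.enorm.pow_const 2).const_mul _) _
      _ ≤ 2 * C₁ + 2 * C₂ := by
          rw [lintegral_const_mul' _ _ ENNReal.ofNat_ne_top, lintegral_const_mul' _ _ ENNReal.ofNat_ne_top]
          gcongr
  · -- `u (θ₁ - θ₂) ∈ L¹` (on the product, where the two pieces add up)
    set μ : Measure (ℝ × UnitAddTorus d) := ((volume : Measure ℝ).restrict (Ioo 0 T)).prod volume with hμ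
    have hmu := h₁.aestronglyMeasurable_uncurry_velocity
    have hF₁ : AEMeasurable (fun p : ℝ × UnitAddTorus d => ‖u p.1 p.2‖ₑ * ‖θ₁ p.1 p.2‖ₑ) μ :=
      hmu.enorm.mul h₁.aestronglyMeasurable_uncurry.enorm
    have hF₂ : AEMeasurable (fun p : ℝ × UnitAddTorus d => ‖u p.1 p.2‖ₑ * ‖θ₂ p.1 p.2‖ₑ) μ :=
      hmu.enorm.mul h₂.aestronglyMeasurable_uncurry.enorm
    have hF : AEMeasurable (fun p : ℝ × UnitAddTorus d => ‖u p.1 p.2‖ₑ * ‖θ₁ p.1 p.2 - θ₂ p.1 p.2‖ₑ) μ :=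
      hmu.enorm.mul (h₁.aestronglyMeasurable_uncurry.sub h₂.aestronglyMeasurable_uncurry).enorm
    have e : ∀ {F : ℝ × UnitAddTorus d → ℝ≥0∞}, AEMeasurable F μ →
        ∫⁻ t in Ioo 0 T, ∫⁻ x, F (t, x) = ∫⁻ p, F p ∂μ := fun hF => (lintegral_prod _ hF).symm
    rw [e hF]
    have h1 : ∫⁻ p, ‖u p.1 p.2‖ₑ * ‖θ₁ p.1 p.2‖ₑ ∂μ < ⊤ := by rw [← e hF₁]; exact h₁.lintegral_mul_lt_top
    have h2 : ∫⁻ p, ‖u p.1 p.2‖ₑ * ‖θ₂ p.1 p.2‖ₑ ∂μ < ⊤ := by rw [← e hF₂]; exact h₂.lintegral_mul_lt_top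
    calc ∫⁻ p, ‖u p.1 p.2‖ₑ * ‖θ₁ p.1 p.2 - θ₂ p.1 p.2‖ₑ ∂μ
        ≤ ∫⁻ p, (‖u p.1 p.2‖ₑ * ‖θ₁ p.1 p.2‖ₑ + ‖u p.1 p.2‖ₑ * ‖θ₂ p.1 p.2‖ₑ) ∂μ := by
          refine lintegral_mono fun p => ?_
          rw [← mul_add]
          gcongr
          exact enorm_sub_le
      _ = (∫⁻ p, ‖u p.1 p.2‖ₑ * ‖θ₁ p.1 p.2‖ₑ ∂μ) + ∫⁻ p, ‖u p.1 p.2‖ₑ * ‖θ₂ p.1 p.2‖ₑ ∂μ :=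
          lintegral_add_left' hF₁ _
      _ < ⊤ := ENNReal.add_lt_top.2 ⟨h1, h2⟩
  · -- the weak formulation, zero datum
    have hprod := integral_prod_sub_weak_eq h₁ h₂ hψ
    have hint : Integrable (fun p : ℝ × UnitAddTorus d => (θ₁ p.1 p.2 - θ₂ p.1 p.2) *
        (FunctionSpaces.Torus.timeDeriv ψ p.1 p.2 + ⟪u p.1 p.2, FunctionSpaces.Torus.gradient (ψ p.1) p.2⟫_ℝ +
          κ * FunctionSpaces.Torus.laplacian (ψ p.1) p.2))
        (((volume : Measure ℝ).restrict (Ioo 0 T)).prod volume) := by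
      have h := (h₁.integrable_weakIntegrand hψ).sub (h₂.integrable_weakIntegrand hψ)
      refine h.congr (Eventually.of_forall fun p => ?_)
      simp only [Pi.sub_apply]
      ring
    rw [integral_prod _ hint] at hprod
    simp only [Pi.zero_apply, zero_mul, integral_zero, add_zero]
    exact hprod

/-- **DiPerna–Lions uniqueness for `L¹ₜ Ḣ¹ₓ` drifts with viscosity** (`p = q = 2`): for `κ > 0`
and `∫₀ᵀ ‖∇u(t)‖_{L²} dt < ∞`, two weak solutions in `L^∞ₜL²ₓ` with the same datum coincide for
a.e. `t ∈ (0,T)`. [cite: DiPernaLions1989, Thm. II.3 (§II.3–II.4)] -/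
theorem unique_of_lintegral_eGradNormSq_rpow_lt_top (hκ : 0 < κ)
    (h₁ : IsWeakScalarTransportOn T κ u θ₀ θ₁) (h₂ : IsWeakScalarTransportOn T κ u θ₀ θ₂)
    (hG : ∫⁻ t in Ioo 0 T, FunctionSpaces.Torus.eGradNormSq (u t) ^ (1 / 2 : ℝ) < ⊤) :
    ∀ᵐ t ∂(volume.restrict (Ioo 0 T)), θ₁ t =ᵐ[volume] θ₂ t := by
  classical
  have hd := sub_of_eq_datum h₁ h₂
  -- the energy inequality with zero datum kills the dissipation
  have hE := hd.energy_ineq_of_lintegral_eGradNormSq_rpow_lt_top hκ (MemLp.zero' (p := 2) (μ := volume)) hG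
  simp only [Pi.zero_apply, enorm_zero, ne_eq, OfNat.ofNat_ne_zero, not_false_eq_true, zero_pow, lintegral_zero,
    nonpos_iff_eq_zero, mul_eq_zero, OfNat.ofNat_ne_zero, false_or] at hE
  rw [eScalarDissipation, mul_eq_zero, ENNReal.ofReal_eq_zero, ← not_lt] at hE
  have hdiss : ∫⁻ t in Ioo 0 T, eScalarGradNormSq (fun x => θ₁ t x - θ₂ t x) = 0 := by
    rcases hE with h | h
    · exact absurd hκ h
    · exact h
  have hae0 : ∀ᵐ t ∂(volume.restrict (Ioo 0 T)), eScalarGradNormSq (fun x => θ₁ t x - θ₂ t x) = 0 :=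
    (lintegral_eq_zero_iff' (aemeasurable_eScalarGradNormSq hd)).1 hdiss
  -- mean zero and integrability of a.e. slice
  have hgood := ae_seis_good hd (integrable_zero _ _ _) (by simp) (δ := 1 / 4) (by norm_num) le_rfl
  filter_upwards [hae0, hgood] with t ht hg
  obtain ⟨-, hmean, -, hint, -⟩ := hg
  -- all Fourier coefficients of the slice vanish
  have hcoef : ∀ k, mFourierCoeff (fun x => ((θ₁ t x - θ₂ t x : ℝ) : ℂ)) k = 0 := by
    intro k
    by_cases hk : k = 0
    · subst hk
      rw [FunctionSpaces.Torus.mFourierCoeff_eq_integral_volume]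
      simp only [neg_zero, mFourier_zero, ContinuousMap.one_apply, one_smul]
      rw [integral_complex_ofReal, hmean, Complex.ofReal_zero]
    · rw [eScalarGradNormSq_eq_tsum, mul_eq_zero] at ht
      rcases ht with h0 | ht
      · exact absurd h0 (by simp [Real.pi_pos.ne'])
      have hterm := (ENNReal.tsum_eq_zero.1 ht) k
      rw [mul_eq_zero] at hterm
      rcases hterm with h0 | h0
      · exact absurd h0 (by
          rw [ENNReal.ofReal_eq_zero, not_le]
          obtain ⟨i, hi⟩ := Function.ne_iff.1 hk
          have hi' : (0 : ℝ) < (k i : ℝ) ^ 2 := by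
            have : (k i : ℝ) ≠ 0 := by exact_mod_cast hi
            positivity
          exact lt_of_lt_of_le hi' (Finset.single_le_sum (f := fun j => ((k j : ℝ)) ^ 2)
            (fun j _ => sq_nonneg _) (Finset.mem_univ i)))
      · simpa using h0
  have hz := FunctionSpaces.Torus.ae_eq_zero_of_forall_mFourierCoeff_eq_zero hint.ofReal hcoef
  filter_upwards [hz] with x hx
  have h' : ((θ₁ t x - θ₂ t x : ℝ) : ℂ) = 0 := by rw [Complex.ofReal_sub]; simpa using hx
  have := Complex.ofReal_eq_zero.1 h'
  linarith

end IsWeakScalarTransportOn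

end Torus

end Literature.Analysis.FluidPDE
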